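import Summits.HubbardSuperconductivity.HubbardSuperconductivity.Theorems.WidthHaldaneTubeKinematics
import Summits.HubbardSuperconductivity.HubbardSuperconductivity.Theorems.WidthHaldaneTubeGauge
import Literature.MathematicalPhysics.QuantumLattice.MagneticHubbardTorusGauge
import Literature.MathematicalPhysics.QuantumLattice.FermionHopAmplitudeBound
import Literature.MathematicalPhysics.QuantumLattice.FinDimSpectrumSectorGibbsLimit
import Literature.MathematicalPhysics.QuantumLattice.InfiniteVolumeChainRegionProofs

/-!
# Bloch's bound on the flux envelope of the Hubbard tube; the twist stiffness per site is at most 2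

Support file for the cruxes stated over `WidthHaldaneDefs` (routes `WidthHaldane`, `SeamInduction`;
items stmt-HubbardSuperconductivity-16311/16312/18509/18510). Main results, all PROVED (no
definitions, no named facts), for every coupling `U`, flux `θ`, particle number `N`, every length
`L ≥ 3`, every width `M ≥ 1` and every labelling `e : Λ ≃ ℤ/L × ℤ/M`:

* `tubeEnergy_le_rayleigh_add` — for every unit vector `ψ` of the sector `(N, S^z = 0)`,
  `E_{L,M}(U; θ, N) ≤ Re⟨ψ, H₀ψ⟩ + θ²M/L`: price the gauge-rotated copies `W_{±θ}ᴴψ` in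
  `H₀ + Tw_{±θ}` (unitary invariance of the sector energy, `WidthHaldaneTubeGauge`), average the two
  bounds using `E(-θ) = E(θ)` so that the bond currents cancel (the `±` trick of Bohm/Watanabe),
  and bound each of the `2LM` longitudinal ordered hops by `(2 - 2cos(θ/L)) · ½ ≤ θ²/(2L²)`
  (`|Re⟨ψ, c†_p c_q ψ⟩| ≤ ½` for `p ≠ q`, `FermionHopAmplitudeBound`);
* `tubeEnergy_le_tubeEnergy_zero_add` — BLOCH'S BOUND `E_{L,M}(U; θ, N) ≤ E_{L,M}(U; 0, N) + θ²M/L`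
  (threading a flux through the long cycle of an `L × M` tube costs `O(M/L)`; Bohm 1949,
  Watanabe 2019 §4.1);
* `tubeStiffness_le_two` — hence the twist stiffness per site obeys `ρ̃_{L,M}(U,δ) ≤ 2` a priori;
* `uniformThermo_iff_canonical` — `UniformThermo` may be checked on the canonical carriers
  `Fin (L·M)`; `uniformThermo_floor_le_two`, `perWidth_floor_le_two` — every stiffness floor of
  `WidthUniformThermodynamics` / `PerWidthThermodynamics` is at most `2` (so `WidthHaldaneBridge` is
  vacuous for `d₀ > 2`, and refuters/provers may restrict to `d₀, d_M ∈ (0, 2]`).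

References: D. Bohm, Phys. Rev. 75 (1949) 502; H. Watanabe, J. Stat. Phys. 177 (2019) 717, §2.2.1,
§4.1; D. J. Scalapino, S. R. White, S. C. Zhang, PRB 47 (1993) 7995 (the stiffness criterion).
-/

noncomputable section

namespace Summit.HubbardSuperconductivity.HubbardSuperconductivity.Theorems.WidthHaldane

set_option linter.dupNamespace false -- summit = problem name (single-conjunct summit), D-0017

open scoped BigOperators Classical Matrix ComplexConjugate
open Matrix Literature.MathematicalPhysics.QuantumLattice
open Summit.HubbardSuperconductivity.HubbardSuperconductivity.Theorems.DeformationLadder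
  (phaseGauge_conj_hamiltonian expect_phaseGauge_conj_hamiltonian expect_hamiltonian_eq)

section BlochBound

variable (L M : ℕ) [NeZero L] [NeZero M] (Λ : Type) [LinearOrder Λ] [Fintype Λ]
  (e : Λ ≃ ZMod L × ZMod M)

/-- **The variational price of the flux, real part** (`L ≥ 3`): for the twist gauge `W_θ`,
`Re⟨ψ, W_θ (H₀ + Tw_θ) W_θᴴ ψ⟩ = Re⟨ψ, H₀ ψ⟩ + Σ_{x∼y,σ} Re[(1 - ω_θ(x,y)) ⟨ψ, c†_{xσ}c_{yσ} ψ⟩]`.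
[cite: Watanabe2019, §2.2.3 and §4.1] -/
theorem re_expect_gauged_tubeH (hL : 3 ≤ L) (U θ : ℝ) (ψ : Fock (Orb Λ)) :
    (expect (phaseGauge (fun z : Λ => Circle.exp (θ / L * ((e z).1.val : ℝ))) *
        (tubeH0 L M Λ e U + tubeTwist L M Λ e θ) *
        (phaseGauge (fun z : Λ => Circle.exp (θ / L * ((e z).1.val : ℝ))))ᴴ) ψ).re =
      (expect (tubeH0 L M Λ e U) ψ).re +
        ∑ x : Λ, ∑ y : Λ, ∑ σ : Fin 2, if (tubeGraph e).Adj x y then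
          ((1 - (if (e x).1 = (e y).1 + 1 ∧ (e x).2 = (e y).2 then Complex.exp (((θ / L : ℝ) : ℂ) * Complex.I)
            else if (e y).1 = (e x).1 + 1 ∧ (e x).2 = (e y).2 then Complex.exp (-(((θ / L : ℝ) : ℂ) * Complex.I))
            else 1)) * expect (creation (orb x σ) * annihilation (orb y σ)) ψ).re
          else 0 := by
  rw [expect_gauged_tubeH L M Λ e hL U θ ψ, tubeH0_eq, expect_hamiltonian_eq, Complex.ofReal_one,
    neg_one_mul, Complex.add_re, Complex.add_re, Complex.neg_re, Complex.neg_re, Complex.re_sum,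
    Complex.re_sum]
  rw [show ∀ (A B C : ℝ), -A + C = -B + C + (B - A) from fun A B C => by ring, add_right_inj,
    ← Finset.sum_sub_distrib]
  refine Finset.sum_congr rfl fun x _ => ?_
  rw [Complex.re_sum, Complex.re_sum, ← Finset.sum_sub_distrib]
  refine Finset.sum_congr rfl fun y _ => ?_
  rw [Complex.re_sum, Complex.re_sum, ← Finset.sum_sub_distrib]
  refine Finset.sum_congr rfl fun σ _ => ?_
  by_cases hadj : (tubeGraph e).Adj x y
  · rw [if_pos hadj, if_pos hadj, if_pos hadj, ← Complex.sub_re]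
    congr 1
    ring
  · rw [if_neg hadj, if_neg hadj, if_neg hadj, sub_self]

omit [NeZero L] [NeZero M] [LinearOrder Λ] [Fintype Λ] in
/-- Reversing the flux conjugates the uniform Peierls weights. [folklore] -/
theorem peierlsWeight_neg (θ : ℝ) (x y : Λ) :
    (if (e x).1 = (e y).1 + 1 ∧ (e x).2 = (e y).2 then Complex.exp ((((-θ) / L : ℝ) : ℂ) * Complex.I)
      else if (e y).1 = (e x).1 + 1 ∧ (e x).2 = (e y).2 then Complex.exp (-((((-θ) / L : ℝ) : ℂ) * Complex.I))
      else 1) =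
    conj (if (e x).1 = (e y).1 + 1 ∧ (e x).2 = (e y).2 then Complex.exp (((θ / L : ℝ) : ℂ) * Complex.I)
      else if (e y).1 = (e x).1 + 1 ∧ (e x).2 = (e y).2 then Complex.exp (-(((θ / L : ℝ) : ℂ) * Complex.I))
      else 1) := by
  split_ifs
  · rw [← Complex.exp_conj, map_mul, Complex.conj_ofReal, Complex.conj_I]
    congr 1
    push_cast
    ring
  · rw [← Complex.exp_conj, map_neg, map_mul, Complex.conj_ofReal, Complex.conj_I]
    congr 1
    push_cast
    ring
  · rw [map_one]

omit [NeZero L] [NeZero M] [LinearOrder Λ] [Fintype Λ] in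
/-- The real parts of the two uniform Peierls weights: `cos(θ/L)` on the longitudinal bonds, `1` on
the transverse ones. [folklore] -/
theorem peierlsWeight_re (θ : ℝ) (x y : Λ) :
    (if (e x).1 = (e y).1 + 1 ∧ (e x).2 = (e y).2 then Complex.exp (((θ / L : ℝ) : ℂ) * Complex.I)
      else if (e y).1 = (e x).1 + 1 ∧ (e x).2 = (e y).2 then Complex.exp (-(((θ / L : ℝ) : ℂ) * Complex.I))
      else 1).re =
    if ((e x).1 = (e y).1 + 1 ∧ (e x).2 = (e y).2) ∨ ((e y).1 = (e x).1 + 1 ∧ (e x).2 = (e y).2)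
      then Real.cos (θ / L) else 1 := by
  by_cases h1 : (e x).1 = (e y).1 + 1 ∧ (e x).2 = (e y).2
  · rw [if_pos h1, if_pos (Or.inl h1), Complex.exp_ofReal_mul_I_re]
  · rw [if_neg h1]
    by_cases h2 : (e y).1 = (e x).1 + 1 ∧ (e x).2 = (e y).2
    · rw [if_pos h2, if_pos (Or.inr h2), ← neg_mul, ← Complex.ofReal_neg, Complex.exp_ofReal_mul_I_re,
        Real.cos_neg]
    · rw [if_neg h2, if_neg (fun h => h.elim h1 h2), Complex.one_re]

omit [NeZero L] [NeZero M] [LinearOrder Λ] [Fintype Λ] in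
/-- **The `±` trick, pointwise**: `Re[(1-ω)h] + Re[(1-conj ω)h] = (2 - 2 Re ω) Re h` — the current
terms cancel between the two orientations of the flux (Watanabe 2019 §2.2.1, the average of the
twists `U_{±m}`). [cite: Watanabe2019, §2.2.1 (twist operator U_m)] -/
theorem re_pm_pointwise (ω h : ℂ) :
    ((1 - ω) * h).re + ((1 - conj ω) * h).re = (2 - 2 * ω.re) * h.re := by
  simp only [Complex.mul_re, Complex.sub_re, Complex.sub_im, Complex.one_re, Complex.one_im,
    Complex.conj_re, Complex.conj_im]
  ring

omit [NeZero L] [NeZero M] [Fintype Λ] in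
/-- **The amplitude bound, pointwise** (`L ≥ 3`): on an adjacent pair the weight `2 - 2 Re ω_θ` is
`2 - 2cos(θ/L)` for the (exactly one) longitudinal orientation and `0` transversally, and a hopping
amplitude between distinct orbitals has `|Re h| ≤ 1/2`. [folklore] -/
theorem weight_pointwise_le (θ : ℝ) (x y : Λ) (r : ℝ) (hr : x ≠ y → |r| ≤ 1 / 2) :
    (if (tubeGraph e).Adj x y then
        (2 - 2 * (if (e x).1 = (e y).1 + 1 ∧ (e x).2 = (e y).2 then Complex.exp (((θ / L : ℝ) : ℂ) * Complex.I)
          else if (e y).1 = (e x).1 + 1 ∧ (e x).2 = (e y).2 then Complex.exp (-(((θ / L : ℝ) : ℂ) * Complex.I))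
          else 1).re) * r
        else 0) ≤
      (2 - 2 * Real.cos (θ / L)) *
        ((if y = e.symm ((e x).1 + 1, (e x).2) then 1 / 2 else 0) +
          (if y = e.symm ((e x).1 - 1, (e x).2) then 1 / 2 else 0)) := by
  have hc : 0 ≤ 2 - 2 * Real.cos (θ / L) := by linarith [Real.cos_le_one (θ / L)]
  have hp : 0 ≤ (if y = e.symm ((e x).1 + 1, (e x).2) then (1 / 2 : ℝ) else 0) := by
    split_ifs <;> norm_num
  have hm : 0 ≤ (if y = e.symm ((e x).1 - 1, (e x).2) then (1 / 2 : ℝ) else 0) := by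
    split_ifs <;> norm_num
  rw [peierlsWeight_re]
  by_cases hadj : (tubeGraph e).Adj x y
  · rw [if_pos hadj]
    have hr' := abs_le.mp (hr hadj.ne)
    by_cases hlong : ((e x).1 = (e y).1 + 1 ∧ (e x).2 = (e y).2) ∨ ((e y).1 = (e x).1 + 1 ∧ (e x).2 = (e y).2)
    · rw [if_pos hlong]
      rcases hlong with h | h
      · have hy : y = e.symm ((e x).1 - 1, (e x).2) := by
          rw [Equiv.eq_symm_apply, Prod.ext_iff]
          exact ⟨eq_sub_of_add_eq h.1.symm, h.2.symm⟩
        rw [if_pos hy]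
        nlinarith
      · have hy : y = e.symm ((e x).1 + 1, (e x).2) := by
          rw [Equiv.eq_symm_apply, Prod.ext_iff]
          exact ⟨h.1, h.2.symm⟩
        rw [if_pos hy]
        nlinarith
    · rw [if_neg hlong]
      nlinarith
  · rw [if_neg hadj]
    nlinarith

/-- **Counting the longitudinal bonds**: `Σ_{x,y,σ} (2 - 2cos(θ/L)) ([y = x + e₁] + [y = x - e₁])/2 = (2 - 2cos(θ/L)) · 2LM`.
[folklore] -/
theorem sum_weight_eq (θ : ℝ) :
    ∑ x : Λ, ∑ y : Λ, ∑ _σ : Fin 2, (2 - 2 * Real.cos (θ / L)) *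
        ((if y = e.symm ((e x).1 + 1, (e x).2) then 1 / 2 else 0) +
          (if y = e.symm ((e x).1 - 1, (e x).2) then 1 / 2 else 0)) =
      (2 - 2 * Real.cos (θ / L)) * (2 * ((L : ℝ) * M)) := by
  simp only [Finset.sum_const, Finset.card_univ, Fintype.card_fin, nsmul_eq_mul, Nat.cast_ofNat]
  have h : ∀ x : Λ, (∑ y : Λ, 2 * ((2 - 2 * Real.cos (θ / L)) *
      ((if y = e.symm ((e x).1 + 1, (e x).2) then 1 / 2 else 0) +
        (if y = e.symm ((e x).1 - 1, (e x).2) then 1 / 2 else 0)))) = 2 * (2 - 2 * Real.cos (θ / L)) := by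
    intro x
    rw [← Finset.mul_sum, ← Finset.mul_sum, Finset.sum_add_distrib, Finset.sum_ite_eq' Finset.univ,
      Finset.sum_ite_eq' Finset.univ, if_pos (Finset.mem_univ _), if_pos (Finset.mem_univ _)]
    ring
  simp only [h, Finset.sum_const, Finset.card_univ, card_carrier L M Λ e, nsmul_eq_mul]
  push_cast
  ring

omit [NeZero L] [NeZero M] [Fintype Λ] in
/-- **The summand of the `±` average, bounded**: for a unit vector, the two orientations of the flux
together weigh the ordered pair `(x, y)` by at most `(2 - 2cos(θ/L)) ([y = x + e₁] + [y = x - e₁])/2`.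
[folklore] -/
theorem summand_pm_le (θ : ℝ) (x y : Λ) (h : ℂ) (hh : x ≠ y → |h.re| ≤ 1 / 2) :
    (if (tubeGraph e).Adj x y then
        ((1 - (if (e x).1 = (e y).1 + 1 ∧ (e x).2 = (e y).2 then Complex.exp (((θ / L : ℝ) : ℂ) * Complex.I)
          else if (e y).1 = (e x).1 + 1 ∧ (e x).2 = (e y).2 then Complex.exp (-(((θ / L : ℝ) : ℂ) * Complex.I))
          else 1)) * h).re else 0) +
      (if (tubeGraph e).Adj x y then
        ((1 - (if (e x).1 = (e y).1 + 1 ∧ (e x).2 = (e y).2 then Complex.exp ((((-θ) / L : ℝ) : ℂ) * Complex.I)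
          else if (e y).1 = (e x).1 + 1 ∧ (e x).2 = (e y).2 then Complex.exp (-((((-θ) / L : ℝ) : ℂ) * Complex.I))
          else 1)) * h).re else 0) ≤
      (2 - 2 * Real.cos (θ / L)) *
        ((if y = e.symm ((e x).1 + 1, (e x).2) then 1 / 2 else 0) +
          (if y = e.symm ((e x).1 - 1, (e x).2) then 1 / 2 else 0)) := by
  have hw := weight_pointwise_le L M Λ e θ x y h.re hh
  rw [peierlsWeight_neg]
  by_cases hadj : (tubeGraph e).Adj x y
  · rw [if_pos hadj, if_pos hadj, re_pm_pointwise]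
    rwa [if_pos hadj] at hw
  · rw [if_neg hadj, if_neg hadj, add_zero]
    rwa [if_neg hadj] at hw

/-- **Bloch's bound for every unit sector vector** (`L ≥ 3`): for `ψ` a unit vector of the sector
`(N, S^z = 0)`, `E_{L,M}(U; θ, N) ≤ Re⟨ψ, H₀ ψ⟩ + θ² M/L` — price the gauge-rotated copies
`W_{±θ}ᴴ ψ` in `H₀ + Tw_{±θ}` (unitary invariance of the sector energy, variational principle),
average the two bounds using `E(-θ) = E(θ)` to cancel the currents, bound each of the `2LM`
longitudinal ordered hops by `(2 - 2cos(θ/L))/2 ≤ θ²/(2L²)`. Bohm 1949 / Watanabe 2019 §2.2, §4.1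
(`O(L_y/L_x)` in two dimensions). [cite: Watanabe2019, §2.2.3 and §4.1] -/
theorem tubeEnergy_le_rayleigh_add (hL : 3 ≤ L) (U θ : ℝ) (N : ℕ) {ψ : Fock (Orb Λ)}
    (hψ : ψ ∈ szSector N 0) (h1 : star ψ ⬝ᵥ ψ = 1) :
    tubeEnergy L M Λ e U θ N ≤ (expect (tubeH0 L M Λ e U) ψ).re + θ ^ 2 * M / L := by
  -- the variational bound in the twist gauge, for both orientations of the flux
  have hgauge : ∀ θ' : ℝ, tubeEnergy L M Λ e U θ' N ≤
      (expect (phaseGauge (fun z : Λ => Circle.exp (θ' / L * ((e z).1.val : ℝ))) *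
        (tubeH0 L M Λ e U + tubeTwist L M Λ e θ') *
        (phaseGauge (fun z : Λ => Circle.exp (θ' / L * ((e z).1.val : ℝ))))ᴴ) ψ).re := by
    intro θ'
    set g : Λ → Circle := fun z : Λ => Circle.exp (θ' / L * ((e z).1.val : ℝ)) with hg
    have hunit := minEnergyOn_szSector_phaseGauge_conj g⁻¹ (tubeH0 L M Λ e U + tubeTwist L M Λ e θ') N 0
    rw [phaseGauge_conjTranspose, inv_inv, ← phaseGauge_conjTranspose g] at hunit
    rw [tubeEnergy_eq, ← hunit]
    exact minEnergyOn_le_rayleigh_of_mem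
      (Matrix.isHermitian_mul_mul_conjTranspose _ (isHermitian_tubeH L M Λ e U θ')) _ hψ h1
  have hp := hgauge θ
  have hm := hgauge (-θ)
  rw [tubeEnergy_neg] at hm
  rw [re_expect_gauged_tubeH L M Λ e hL] at hp hm
  -- add the two bounds: the weights combine to `2 - 2 Re ω_θ`
  have hsum : (∑ x : Λ, ∑ y : Λ, ∑ σ : Fin 2, if (tubeGraph e).Adj x y then
      ((1 - (if (e x).1 = (e y).1 + 1 ∧ (e x).2 = (e y).2 then Complex.exp (((θ / L : ℝ) : ℂ) * Complex.I)
        else if (e y).1 = (e x).1 + 1 ∧ (e x).2 = (e y).2 then Complex.exp (-(((θ / L : ℝ) : ℂ) * Complex.I))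
        else 1)) * expect (creation (orb x σ) * annihilation (orb y σ)) ψ).re else 0) +
      (∑ x : Λ, ∑ y : Λ, ∑ σ : Fin 2, if (tubeGraph e).Adj x y then
      ((1 - (if (e x).1 = (e y).1 + 1 ∧ (e x).2 = (e y).2 then Complex.exp ((((-θ) / L : ℝ) : ℂ) * Complex.I)
        else if (e y).1 = (e x).1 + 1 ∧ (e x).2 = (e y).2 then Complex.exp (-((((-θ) / L : ℝ) : ℂ) * Complex.I))
        else 1)) * expect (creation (orb x σ) * annihilation (orb y σ)) ψ).re else 0) ≤
      2 * (θ ^ 2 * M / L) := by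
    rw [← Finset.sum_add_distrib]
    calc _ ≤ ∑ x : Λ, ∑ y : Λ, ∑ _σ : Fin 2, (2 - 2 * Real.cos (θ / L)) *
          ((if y = e.symm ((e x).1 + 1, (e x).2) then 1 / 2 else 0) +
            (if y = e.symm ((e x).1 - 1, (e x).2) then 1 / 2 else 0)) := by
          refine Finset.sum_le_sum fun x _ => ?_
          rw [← Finset.sum_add_distrib]
          refine Finset.sum_le_sum fun y _ => ?_
          rw [← Finset.sum_add_distrib]
          refine Finset.sum_le_sum fun σ _ => ?_
          exact summand_pm_le L M Λ e θ x y _ (fun hxy =>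
            abs_re_star_dotProduct_creation_mul_annihilation_mulVec_le_half h1
              (fun h => hxy (congrArg (fun o : Orb Λ => (ofLex o).1) h)))
      _ = (2 - 2 * Real.cos (θ / L)) * (2 * ((L : ℝ) * M)) := sum_weight_eq L M Λ e θ
      _ ≤ (θ / L) ^ 2 * (2 * ((L : ℝ) * M)) := by
          have := two_sub_two_mul_cos_le_sq (θ / L)
          have h0 : 0 ≤ 2 * ((L : ℝ) * M) := by positivity
          nlinarith
      _ = 2 * (θ ^ 2 * M / L) := by
          have hL0 : (L : ℝ) ≠ 0 := by exact_mod_cast (NeZero.ne L)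
          field_simp
  linarith

/-- **Bloch's bound on the flux envelope of the tube** (`L ≥ 3`): for every `U`, every flux `θ`,
every particle number `N`, every width `M ≥ 1` and every labelling,
`E_{L,M}(U; θ, N) ≤ E_{L,M}(U; 0, N) + θ² M/L` — threading a flux through the long cycle of an
`L × M` tube costs at most `O(M/L)` (Bohm 1949; Watanabe 2019 §4.1). (If the sector has no unit
vector both sides are the junk value `sInf ∅ = 0`.) [cite: Watanabe2019, §2.2.3 and §4.1] -/
theorem tubeEnergy_le_tubeEnergy_zero_add (hL : 3 ≤ L) (U θ : ℝ) (N : ℕ) :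
    tubeEnergy L M Λ e U θ N ≤ tubeEnergy L M Λ e U 0 N + θ ^ 2 * M / L := by
  have hc : 0 ≤ θ ^ 2 * M / L := by positivity
  set K := szSector (Λ := Λ) N 0 with hK
  by_cases hne : ∃ ψ ∈ K, star ψ ⬝ᵥ ψ = (1 : ℂ)
  · obtain ⟨ψ₀, hψ₀, h₀⟩ := hne
    have hS : {E : ℝ | ∃ ψ ∈ K, star ψ ⬝ᵥ ψ = 1 ∧
        E = (star ψ ⬝ᵥ (tubeH0 L M Λ e U *ᵥ ψ)).re}.Nonempty := ⟨_, ψ₀, hψ₀, h₀, rfl⟩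
    have h0 : tubeEnergy L M Λ e U 0 N = sInf {E : ℝ | ∃ ψ ∈ K, star ψ ⬝ᵥ ψ = 1 ∧
        E = (star ψ ⬝ᵥ (tubeH0 L M Λ e U *ᵥ ψ)).re} := by
      rw [tubeEnergy_zero]; rfl
    refine le_of_forall_pos_lt_add fun ε hε => ?_
    obtain ⟨E, ⟨ψ, hψ, h1, rfl⟩, hE⟩ := exists_lt_of_csInf_lt hS
      (lt_add_of_pos_right (sInf {E : ℝ | ∃ ψ ∈ K, star ψ ⬝ᵥ ψ = 1 ∧
        E = (star ψ ⬝ᵥ (tubeH0 L M Λ e U *ᵥ ψ)).re}) hε)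
    have h := tubeEnergy_le_rayleigh_add L M Λ e hL U θ N hψ h1
    rw [h0]
    rw [Literature.MathematicalPhysics.QuantumLattice.expect] at h
    linarith
  · have hempty : ∀ A : Matrix (Finset (Orb Λ)) (Finset (Orb Λ)) ℂ, A.minEnergyOn K = 0 := fun A => by
      unfold Matrix.minEnergyOn
      convert Real.sInf_empty
      ext E
      simp only [Set.mem_setOf_eq, Set.mem_empty_iff_false, iff_false, not_exists, not_and]
      exact fun ψ hψ h1 _ => hne ⟨ψ, hψ, h1⟩
    rw [tubeEnergy_eq, tubeEnergy_eq, hempty, hempty]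
    linarith

/-- **A-priori bound on the twist stiffness per site**: `ρ̃_{L,M}(U, δ) ≤ 2` for every `U`, every
`δ`, every `L ≥ 3`, every `M ≥ 1` and every labelling — so the stiffness floor `d₀ ≤ ρ̃` of
`WidthUniformThermodynamics` / `PerWidthThermodynamics` can only hold with `d₀ ≤ 2`, and
`WidthHaldaneBridge` is vacuous for `d₀ > 2`. [folklore] -/
theorem tubeStiffness_le_two (hL : 3 ≤ L) (U δ : ℝ) : tubeStiffness L M Λ e U δ ≤ 2 := by
  rw [tubeStiffness_eq]
  have hL0 : (0 : ℝ) < L := by exact_mod_cast Nat.pos_of_ne_zero (NeZero.ne L)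
  have hM0 : (0 : ℝ) < M := by exact_mod_cast Nat.pos_of_ne_zero (NeZero.ne M)
  have hπ : (0 : ℝ) < (Real.pi / 3) ^ 2 := by positivity
  have h := tubeEnergy_le_tubeEnergy_zero_add L M Λ e hL U (Real.pi / 3) (tubeFilling L M δ)
  rw [div_le_iff₀ (by positivity)]
  have key : 2 * (L : ℝ) * ((Real.pi / 3) ^ 2 * M / L) = 2 * ((Real.pi / 3) ^ 2 * M) := by
    field_simp
  nlinarith [mul_le_mul_of_nonneg_left h (by positivity : (0 : ℝ) ≤ 2 * L)]

end BlochBound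

/-! ### The canonical carrier `Fin (L M)` and the a-priori size of the stiffness floors -/

section Canonical

variable (L M : ℕ) [NeZero L] [NeZero M]

/-- **Canonical-carrier reduction of the thermodynamic hypothesis**: `UniformThermo` holds iff it
holds on the canonical carriers `Fin (L·M)` labelled by `finProdFinEquiv` and `ZMod.finEquiv`
(the two responses do not depend on the labelling, `tubeStiffness_relabel`,
`tubePairCompressibility_relabel`). [folklore] -/
theorem uniformThermo_iff_canonical (U δ d₀ k₀ : ℝ) (M₁ L₀ : ℕ) :
    UniformThermo U δ d₀ k₀ M₁ L₀ ↔
      ∀ (L M : ℕ) [NeZero L] [NeZero M], Even L → Even M → M₁ ≤ M → M ≤ L → L₀ ≤ L →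
        d₀ ≤ tubeStiffness L M (Fin (L * M))
            (finProdFinEquiv.symm.trans
              (Equiv.prodCongr (ZMod.finEquiv L).toEquiv (ZMod.finEquiv M).toEquiv)) U δ ∧
          0 < tubePairCompressibility L M (Fin (L * M))
            (finProdFinEquiv.symm.trans
              (Equiv.prodCongr (ZMod.finEquiv L).toEquiv (ZMod.finEquiv M).toEquiv)) U δ ∧
          tubePairCompressibility L M (Fin (L * M))
            (finProdFinEquiv.symm.trans
              (Equiv.prodCongr (ZMod.finEquiv L).toEquiv (ZMod.finEquiv M).toEquiv)) U δ ≤ k₀ := by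
  constructor
  · intro h L M _ _ hLe hMe hM hML hL
    exact h L M hLe hMe hM hML hL (Fin (L * M)) _
  · intro h L M _ _ hLe hMe hM hML hL Λ _ _ e
    rw [tubeStiffness_relabel L M Λ e (Fin (L * M))
        (finProdFinEquiv.symm.trans (Equiv.prodCongr (ZMod.finEquiv L).toEquiv (ZMod.finEquiv M).toEquiv)),
      tubePairCompressibility_relabel L M Λ e (Fin (L * M))
        (finProdFinEquiv.symm.trans (Equiv.prodCongr (ZMod.finEquiv L).toEquiv (ZMod.finEquiv M).toEquiv))]
    exact h L M hLe hMe hM hML hL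

/-- **The width-uniform stiffness floor is at most `2`**: if `UniformThermo U δ d₀ k₀ M₁ L₀` holds
then `d₀ ≤ 2` (instantiate at the even square tube of side `2(L₀ + M₁ + 2)` and use Bloch's bound
`ρ̃ ≤ 2`). Hence `WidthHaldaneBridge` is vacuously true for every `d₀ > 2`, and any witness of
`WidthUniformThermodynamics` has `d₀ ≤ 2`. [folklore] -/
theorem uniformThermo_floor_le_two {U δ d₀ k₀ : ℝ} {M₁ L₀ : ℕ} (h : UniformThermo U δ d₀ k₀ M₁ L₀) :
    d₀ ≤ 2 := by
  set n : ℕ := 2 * (L₀ + M₁ + 2) with hn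
  haveI : NeZero n := ⟨by omega⟩
  have hst := (h n n (even_two_mul _) (even_two_mul _) (by omega) le_rfl (by omega) (Fin (n * n))
    (finProdFinEquiv.symm.trans (Equiv.prodCongr (ZMod.finEquiv n).toEquiv (ZMod.finEquiv n).toEquiv))).1
  exact hst.trans (tubeStiffness_le_two n n (Fin (n * n)) _ (by omega) U δ)

/-- **Every per-width stiffness floor is at most `2`**: if at width `M` the per-width matrix of
`PerWidthThermodynamics` holds with constants `(d, k, L₁)`, then `d ≤ 2` (instantiate at the even
length `2(L₁ + M + 2)`). [folklore] -/
theorem perWidth_floor_le_two {U δ d k : ℝ} {L₁ : ℕ}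
    (h : ∀ (L : ℕ) [NeZero L], Even L → M ≤ L → L₁ ≤ L →
      ∀ (Λ : Type) [LinearOrder Λ] [Fintype Λ] (e : Λ ≃ ZMod L × ZMod M),
        d ≤ tubeStiffness L M Λ e U δ ∧ 0 < tubePairCompressibility L M Λ e U δ ∧
          tubePairCompressibility L M Λ e U δ ≤ k) :
    d ≤ 2 := by
  set n : ℕ := 2 * (L₁ + M + 2) with hn
  haveI : NeZero n := ⟨by omega⟩
  have hst := (h n (even_two_mul _) (by omega) (by omega) (Fin (n * M))
    (finProdFinEquiv.symm.trans (Equiv.prodCongr (ZMod.finEquiv n).toEquiv (ZMod.finEquiv M).toEquiv))).1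
  exact hst.trans (tubeStiffness_le_two n M (Fin (n * M)) _ (by omega) U δ)

end Canonical

end Summit.HubbardSuperconductivity.HubbardSuperconductivity.Theorems.WidthHaldane

end
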